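import Literature.NumberTheory.LFunctions.WeilExplicitDirichletWeilFormPF
import Literature.NumberTheory.LFunctions.WeilExplicitArchTermParityProofs
import Literature.Analysis.SpecialFunctions.InvSinhEulerMascheroni
import HarnessLib

/-!
# Weil's (11) in Weil's own `PF` form equals the digamma form: the dictionary PROVED

DISCHARGE of the named fact
`Literature.NumberTheory.LFunctions.weilExplicitRHSWeil_eq_weilFunctionalChar_of_neZero`
(`WeilExplicitDirichletWeilForm.lean`, guarded form): for every modulus `q ≥ 1`, every Dirichlet
character `χ` mod `q` and every test function `g ∈ C_c^∞`,

  `weilExplicitRHSWeil χ g = weilFunctionalChar χ g`,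

i.e. (the polar and prime terms being literally the same on both sides) Weil's dictionary
`−PF ∫ g(x) K_{1,a}(x) dx = (1/2π) ∫ ĝ(1/2+it) Re ψ(1/4 + a/2 + it/2) dt + g(0) log 2`, `a ∈ {0,1}`
the parity (A. Weil, *Sur les "formules explicites" de la théorie des nombres premiers*, Comm. Sém.
Math. Univ. Lund 1952, pp. 258–261: (5), (10) and the evaluation of `PF` against `Re Γ'/Γ`).

Assembly of three tree files:
* `WeilExplicitDirichletWeilFormPF.lean`: `PF ∫ g K_{1,a} = ∫_ℝ R_a(g) − g(0) log(a + 1/2)`,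
  `R_a(g)(x) = e^{−(a+1/2)|x|}(g(x)/(1 − e^{−2|x|}) − g(0)/(2|x|))`;
* `WeilExplicitArchTermParityProofs.lean` (Bombieri (2.8) with parity):
  `weilArchIntegralChar a g = −2π[(log 4 + γ) g(0) + ∫₀^∞ (e^{(1/2−a)t}k(t) − 2g(0)) dt/(2 sinh t)]`,
  `k(t) = g(t) + g(−t)`;
* `InvSinhEulerMascheroni.lean`: `∫₀^∞ (1/sinh t − e^{−βt}/t) dt = γ + log 2 + log β`;
and the pointwise identity `R_a(t) + R_a(−t) = (e^{(1/2−a)t}k(t) − 2g(0))/(2 sinh t) + g(0)(1/sinh t − e^{−(a+1/2)t}/t)`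
on `t > 0`, after which everything cancels (`log 4 = 2 log 2`).

## References

* A. Weil, *Sur les "formules explicites" de la théorie des nombres premiers*, Comm. Sém. Math.
  Univ. Lund (1952), 252–265, (5) p. 254, (10) p. 258, pp. 260–262. [Weil1952FormulesExplicites]
* E. Bombieri, *Remarks on Weil's quadratic functional in the theory of prime numbers I*, Rend.
  Mat. Acc. Lincei (9) 11 (2000), §2 (2.8). [Bombieri2000Weil]
-/

noncomputable section

open Complex Filter Set MeasureTheory Topology
open scoped Real

namespace Literature.NumberTheory.LFunctions

namespace WeilPF

variable {g : ℝ → ℂ}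

/-- Folding an integral over `ℝ` onto `(0, ∞)`: `∫_ℝ F = ∫₀^∞ (F(t) + F(−t)) dt`. [folklore] -/
private theorem integral_eq_Ioi_add {F : ℝ → ℂ} (hF : Integrable F) :
    ∫ x, F x = ∫ t in Ioi (0 : ℝ), (F t + F (-t)) := by
  have h1 : IntegrableOn F (Ioi 0) := hF.integrableOn
  have h2 : IntegrableOn (fun t : ℝ ↦ F (-t)) (Ioi 0) := hF.comp_neg.integrableOn
  rw [integral_add h1 h2, integral_comp_neg_Ioi 0 F, neg_zero,
    ← intervalIntegral.integral_Iic_add_Ioi (b := 0) hF.integrableOn hF.integrableOn]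
  -- order of summands
  ring

/-- **The pointwise dictionary** between Weil's regularised `PF` integrand and Bombieri's, `t > 0`:
`R_a(t) + R_a(−t) = (e^{(1/2−a)t}k(t) − 2g(0))/(2 sinh t) + g(0)(1/sinh t − e^{−(a+1/2)t}/t)`,
`k = g + g(−·)` (`e^{−(a+1/2)t}/(1 − e^{−2t}) = e^{(1/2−a)t}/(2 sinh t)`). [folklore] -/
private theorem weilPFRegular_add_neg {t : ℝ} (ht : 0 < t) (a : ℕ) (g : ℝ → ℂ) :
    weilPFRegular a g t + weilPFRegular a g (-t) =
      ((Real.exp ((1 / 2 - a) * t) : ℂ) * (g t + g (-t)) - 2 * g 0) / (2 * Real.sinh t : ℂ) +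
        g 0 * ((1 / Real.sinh t - Real.exp (-(((a : ℝ) + 1 / 2) * t)) / t : ℝ) : ℂ) := by
  have hsinh : 0 < Real.sinh t := Real.sinh_pos_iff.2 ht
  have hD : 0 < 1 - Real.exp (-(2 * t)) := by
    linarith [Real.exp_lt_one_iff.2 (by linarith : -(2 * t) < 0)]
  -- the kernel identity `e^{−(a+1/2)t}/(1 − e^{−2t}) = e^{(1/2−a)t}/(2 sinh t)`
  have hker : Real.exp (-(((a : ℝ) + 1 / 2) * t)) / (1 - Real.exp (-(2 * t))) =
      Real.exp ((1 / 2 - a) * t) / (2 * Real.sinh t) := by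
    have h := exp_neg_div_one_sub_exp ht
    rw [show -(((a : ℝ) + 1 / 2) * t) = (1 / 2 - a) * t + -t by ring, Real.exp_add, mul_div_assoc, h]
    ring
  have hkerC : (Real.exp (-(((a : ℝ) + 1 / 2) * t)) : ℂ) / ((1 - Real.exp (-(2 * t)) : ℝ) : ℂ) =
      (Real.exp ((1 / 2 - a) * t) : ℂ) / (2 * Real.sinh t : ℂ) := by
    have := congrArg (fun r : ℝ ↦ (r : ℂ)) hker
    push_cast at this ⊢
    exact this
  simp only [weilPFRegular, abs_neg, abs_of_pos ht]
  have hDc : ((1 - Real.exp (-(2 * t)) : ℝ) : ℂ) ≠ 0 := by exact_mod_cast hD.ne'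
  have h2t : ((2 * t : ℝ) : ℂ) ≠ 0 := by exact_mod_cast (by positivity : (2 * t : ℝ) ≠ 0)
  have htc : (t : ℂ) ≠ 0 := by exact_mod_cast ht.ne'
  have hsc : (2 * Real.sinh t : ℂ) ≠ 0 := by exact_mod_cast (by positivity : (2 * Real.sinh t : ℝ) ≠ 0)
  have hsc' : ((Real.sinh t : ℝ) : ℂ) ≠ 0 := by exact_mod_cast hsinh.ne'
  -- rewrite `e^{-βt}/(1 - e^{-2t})` through the kernel identity, then clear denominators
  have e1 : (Real.exp (-(((a : ℝ) + 1 / 2) * t)) : ℂ) =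
      (Real.exp ((1 / 2 - a) * t) : ℂ) / (2 * Real.sinh t : ℂ) * ((1 - Real.exp (-(2 * t)) : ℝ) : ℂ) := by
    rw [← hkerC, div_mul_cancel₀ _ hDc]
  push_cast at e1 hDc h2t ⊢
  rw [e1]
  field_simp
  ring

/-- **Weil's `PF` against Bombieri's regularisation** (for test `g`, `a ∈ {0,1}`):
`PF ∫ g K_{1,a} = ∫₀^∞ (e^{(1/2−a)t}k(t) − 2g(0)) dt/(2 sinh t) + g(0)(γ + log 2)`
(`∫₀^∞ (1/sinh t − e^{−(a+1/2)t}/t) dt = γ + log 2 + log(a+1/2)` cancels the `−g(0) log(a+1/2)`).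
[cite: Weil1952FormulesExplicites, pp. 260–261 (evaluation of PF ∫ F K_{1,f})] -/
theorem weilPFIntegralK1_eq_bombieri (hg : IsWeilTest g) (a : ℕ) :
    weilPFIntegralK1 a g =
      (∫ t in Ioi (0 : ℝ), ((Real.exp ((1 / 2 - a) * t) : ℂ) * (g t + g (-t)) - 2 * g 0) /
          (2 * Real.sinh t : ℂ)) +
        g 0 * ((Real.eulerMascheroniConstant + Real.log 2 : ℝ) : ℂ) := by
  set β : ℝ := (a : ℝ) + 1 / 2 with hβ
  have hβ0 : 0 < β := by positivity
  have hR := integrable_weilPFRegular hg a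
  -- the constant integrand and its integral
  have hcI : IntegrableOn (fun t : ℝ ↦ 1 / Real.sinh t - Real.exp (-(β * t)) / t) (Ioi 0) :=
    Literature.Analysis.SpecialFunctions.integrableOn_inv_sinh_sub_exp_neg_mul_div hβ0
  have hcV : ∫ t in Ioi (0 : ℝ), (1 / Real.sinh t - Real.exp (-(β * t)) / t) =
      Real.eulerMascheroniConstant + Real.log 2 + Real.log β :=
    Literature.Analysis.SpecialFunctions.integral_inv_sinh_sub_exp_neg_mul_div hβ0
  have hcIC : IntegrableOn (fun t : ℝ ↦ g 0 * ((1 / Real.sinh t - Real.exp (-(β * t)) / t : ℝ) : ℂ))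
      (Ioi 0) := (hcI.ofReal (𝕜 := ℂ)).const_mul (g 0)
  -- fold and identify
  have hsum : IntegrableOn (fun t : ℝ ↦ weilPFRegular a g t + weilPFRegular a g (-t)) (Ioi 0) :=
    hR.integrableOn.add hR.comp_neg.integrableOn
  have hB : IntegrableOn (fun t : ℝ ↦ ((Real.exp ((1 / 2 - a) * t) : ℂ) * (g t + g (-t)) - 2 * g 0) /
      (2 * Real.sinh t : ℂ)) (Ioi 0) := by
    refine (hsum.sub hcIC).congr_fun (fun t (ht : 0 < t) ↦ ?_) measurableSet_Ioi
    simp only [Pi.sub_apply]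
    rw [weilPFRegular_add_neg ht, hβ]
    ring
  have hfold := integral_eq_Ioi_add hR
  have hsplit : ∫ t in Ioi (0 : ℝ), (weilPFRegular a g t + weilPFRegular a g (-t)) =
      (∫ t in Ioi (0 : ℝ), ((Real.exp ((1 / 2 - a) * t) : ℂ) * (g t + g (-t)) - 2 * g 0) /
          (2 * Real.sinh t : ℂ)) +
        ∫ t in Ioi (0 : ℝ), g 0 * ((1 / Real.sinh t - Real.exp (-(β * t)) / t : ℝ) : ℂ) := by
    rw [← integral_add hB hcIC]
    refine setIntegral_congr_fun measurableSet_Ioi fun t (ht : 0 < t) ↦ ?_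
    rw [weilPFRegular_add_neg ht, hβ]
  rw [weilPFIntegralK1_eq hg a, hfold, hsplit, integral_const_mul, integral_complex_ofReal, hcV]
  push_cast
  ring

end WeilPF

/-! ### The discharge -/

open WeilPF WeilArchParity in
/-- **DISCHARGE of `Literature.NumberTheory.LFunctions.weilExplicitRHSWeil_eq_weilFunctionalChar_of_neZero`:
Weil's printed right-hand side of (11) (with the `PF ∫ F K_{1,a}` archimedean term, p. 262) equals
the digamma form `weilFunctionalChar` on test functions**, for every modulus `q ≥ 1` and every
character `χ` mod `q`: the dictionary `−PF ∫ g K_{1,a} = (1/2π)∫ ĝ(1/2+it) Re ψ(1/4+a/2+it/2) dt + g(0) log 2`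
(Weil (5), (10), pp. 258–261) — Weil's `PF` against Bombieri's regularisation
(`weilPFIntegralK1_eq_bombieri`) and Bombieri's (2.8) with parity (`weilArchIntegralChar_eq_position`).
[cite: Weil1952FormulesExplicites, (5) p. 254, (10) p. 258, pp. 260–262; Bombieri2000Weil, §2 (2.8)] -/
theorem weilExplicitRHSWeil_eq_weilFunctionalChar_of_neZero_holds :
    weilExplicitRHSWeil_eq_weilFunctionalChar_of_neZero := by
  intro q _ χ g hg
  have ha : charParity χ ≤ 1 := charParity_le_one χ
  have hPF := weilPFIntegralK1_eq_bombieri hg (charParity χ)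
  have hA := weilArchIntegralChar_eq_position hg ha
  have hq0 : (q : ℝ) ≠ 0 := Nat.cast_ne_zero.2 (NeZero.ne q)
  have hlogq : Real.log ((q : ℝ) / (2 * π)) = Real.log q - Real.log 2 - Real.log π := by
    rw [Real.log_div hq0 (by positivity), Real.log_mul two_ne_zero Real.pi_ne_zero]
    ring
  have hlog4 : Real.log 4 = 2 * Real.log 2 := by
    rw [show (4 : ℝ) = 2 ^ 2 by norm_num, Real.log_pow]; norm_num
  simp only [weilExplicitRHSWeil, weilFunctionalChar, weilArchTermChar, hPF, hA, hlogq]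
  have hπ : (π : ℂ) ≠ 0 := Complex.ofReal_ne_zero.2 Real.pi_ne_zero
  push_cast
  rw [hlog4] at *
  field_simp
  push_cast
  ring

end Literature.NumberTheory.LFunctions

end
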